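import Summits.Parity.GeneralizedHardyLittlewood.Theorems.Dhl42Integrability
import Summits.Parity.GeneralizedHardyLittlewood.Theorems.Dhl42Tame
import Literature.Analysis.ValidatedNumerics.ExpPoly.Calculus

/-!
# DHL[42,2] certificate — Lemma 6.1(a), part 1: the density `dens f`, simplex integrands, peeling the first coordinate

For one-variable exponential sums `f_j` (`ES`), the density of `Σ_j t_j` under `Π_j f_j(t_j) dt_j`
on the orthant is the iterated convolution `dens f`, an explicit exp-polynomial (`EP.conv` of the
tree's `ExpPoly/Calculus`). This file: bounds for `ES`/`EP` on compact intervals; `dens`, the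
simplex integrand `1[t ∈ B·R_{n+1}] Π_j f_j(t_j) φ(Σ_j t_j)` and test functions `TestFn B φ`
(measurable, bounded on `[0, B]`); tameness and integrability of the simplex integrand; the base
case `n = 0`; and the peeling step — the first coordinate separated (`simplexIntegrand_cons`, Fubini
on `ℝ × ℝⁿ` from `Dhl42Tame`), the translation `v ↦ v + s` (`pairing_translate`), the reflection
identity for `EP.conv` (`conv_reflect`) and the Fubini swap on the triangle `0 ≤ s ≤ u ≤ B` (`triK`,
`triangle_swap`). General `n`; nothing here refers to the §7 data. Continued in
`Dhl42DensityFormula` (the identity `integral_simplex_eq_dens` itself).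

Origin: `Dhl42/ClosedForm/Density.lean` of the DHL[42,2] certificate package (pub-dhl42 bundle,
archive blob `18cce9e3`; sha256[:16] of the file `057bcc044d8a75b1`; paper snapshot =
`paper/main.tex` v1), lines :27–:294; statements and proofs unchanged except: namespace
`Dhl42.ClosedForm` → `Summit.Parity.GeneralizedHardyLittlewood.Theorems.Dhl42.ClosedForm`,
`open TpY4Dhl42` dropped (the certificate's Part 1–7 declarations, migrated to
`Summit.Parity.GeneralizedHardyLittlewood.Theorems.Dhl42` in batches B2/B3, are in scope in the
sub-namespace), `Dhl42.ExpPoly` → the tree's `Literature.Analysis.ValidatedNumerics.ExpPoly`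
(`ExpPoly/*.lean`, batch B1), the package's `simplexSet n B` replaced by the tree's definitionally
equal `Literature.NumberTheory.Sieve.scaledSimplex n B` (also inside the names of the B2/B3 lemmas
used), docstrings added where missing. Package-internal references in the verbatim docstrings
(`Density.lean`, `Setup.lean`, `KernelBridge.lean`, `MainI.…`) refer to that package (paper Appendix
B).

Declarations (21): `exists_bound_Icc_of_continuous`, `ES.exists_bound_Icc`, `EP.exists_bound_Icc`,
`dens`, `simplexIntegrand`, `TestFn`, `TestFn.shift`, `tame_simplexIntegrand`,
`integrable_simplexIntegrand`, `integral_simplex_one`, `simplexIntegrand_eq_zero_of_neg`,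
`simplexIntegrand_cons`, `integral_simplexIntegrand_cons`, `pairing_translate`, `conv_reflect`,
`triK`, `measurableSet_tri`, `integrable_triK`, `integral_triK_snd`, `integral_triK_fst`,
`triangle_swap`.
-/

open MeasureTheory Set Filter Real intervalIntegral
open Literature.Analysis.ValidatedNumerics.ExpPoly
open Literature.NumberTheory.Sieve (scaledSimplex measurableSet_scaledSimplex apply_mem_Icc_of_mem_scaledSimplex volume_scaledSimplex_lt_top)

namespace Summit.Parity.GeneralizedHardyLittlewood.Theorems.Dhl42.ClosedForm

noncomputable section

/-! ### Bounds for exponential sums and block sums on compact intervals -/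

/-- A continuous real function is bounded in absolute value on `[a, b]`, with a non-negative bound.
-/
theorem exists_bound_Icc_of_continuous {g : ℝ → ℝ} (hg : Continuous g) (a b : ℝ) :
    ∃ C, 0 ≤ C ∧ ∀ x ∈ Icc a b, |g x| ≤ C := by
  obtain ⟨C, hC⟩ := isCompact_Icc.exists_bound_of_continuousOn (hg.continuousOn (s := Icc a b))
  refine ⟨max C 0, le_max_right _ _, fun x hx => le_trans ?_ (le_max_left _ _)⟩
  have := hC x hx
  rwa [Real.norm_eq_abs] at this

/-- An exponential sum `⟦f⟧` is bounded on `[a, b]`. -/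
theorem ES.exists_bound_Icc (f : ES) (a b : ℝ) : ∃ C, 0 ≤ C ∧ ∀ x ∈ Icc a b, |ES.eval f x| ≤ C :=
  exists_bound_Icc_of_continuous (ES.continuous_eval f) a b

/-- An exp-polynomial `⟦L⟧` is bounded on `[a, b]`. -/
theorem EP.exists_bound_Icc (L : EP) (a b : ℝ) : ∃ C, 0 ≤ C ∧ ∀ x ∈ Icc a b, |EP.eval L x| ≤ C :=
  exists_bound_Icc_of_continuous (EP.continuous_eval L) a b

/-! ### The density of `Σ t_j` -/

/-- The density of `Σ_{j ≤ n} t_j` under `Π_j f_j(t_j) dt_j` on `[0,∞)^{n+1}`, as a block sum: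
coordinate `0` is peeled last. -/
def dens : (n : ℕ) → (Fin (n + 1) → ES) → EP
  | 0, f => ES.toEP (f 0)
  | n + 1, f => EP.conv (f 0) (dens n (Fin.tail f))

/-- The integrand `1[t ∈ B·R_{n+1}] · Π_j f_j(t_j) · φ(Σ_j t_j)`. -/
def simplexIntegrand (n : ℕ) (f : Fin (n + 1) → ES) (B : ℝ) (φ : ℝ → ℝ) (t : Fin (n + 1) → ℝ) : ℝ :=
  (scaledSimplex (n + 1) B).indicator (fun t => (∏ j, ES.eval (f j) (t j)) * φ (∑ j, t j)) t

/-- Test functions: measurable and bounded on `[0, B]`. -/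
structure TestFn (B : ℝ) (φ : ℝ → ℝ) : Prop where
  measurable : Measurable φ
  bdd : ∃ C, 0 ≤ C ∧ ∀ v ∈ Icc 0 B, |φ v| ≤ C

/-- Test functions are stable under the translation `v ↦ φ(s + v)` (`s ≥ 0`), as a test function on
`[0, B − s]`. -/
theorem TestFn.shift {B : ℝ} {φ : ℝ → ℝ} (h : TestFn B φ) {s : ℝ} (hs : 0 ≤ s) :
    TestFn (B - s) (fun v => φ (s + v)) := by
  obtain ⟨C, hC0, hC⟩ := h.bdd
  refine ⟨h.measurable.comp (measurable_const.add measurable_id), C, hC0, fun v hv => hC _ ?_⟩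
  exact ⟨by linarith [hv.1], by linarith [hv.2]⟩

/-- The simplex integrand is tame (measurable, bounded, supported in the simplex). -/
theorem tame_simplexIntegrand (n : ℕ) (f : Fin (n + 1) → ES) (B : ℝ) {φ : ℝ → ℝ} (hφ : TestFn B φ) :
    Tame (scaledSimplex (n + 1) B) (simplexIntegrand n f B φ) := by
  -- bounds for each factor on [0, B]
  choose C hC0 hC using fun j => ES.exists_bound_Icc (f j) 0 B
  obtain ⟨D, hD0, hD⟩ := hφ.bdd
  refine ⟨?_, ⟨(∏ j, C j) * D, mul_nonneg (Finset.prod_nonneg fun j _ => hC0 j) hD0, fun t => ?_⟩,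
    fun t ht => indicator_of_notMem ht _⟩
  · refine Measurable.indicator ?_ (measurableSet_scaledSimplex _ _)
    exact (Finset.measurable_prod _ fun j _ =>
      (ES.continuous_eval (f j)).measurable.comp (measurable_pi_apply j)).mul
      (hφ.measurable.comp (measurable_sum_coord _))
  · by_cases ht : t ∈ scaledSimplex (n + 1) B
    · rw [simplexIntegrand, indicator_of_mem ht, abs_mul, Finset.abs_prod]
      have hsum : ∑ j, t j ∈ Icc 0 B := ⟨Finset.sum_nonneg fun j _ => ht.1 j, ht.2⟩
      exact mul_le_mul (Finset.prod_le_prod (fun j _ => abs_nonneg _)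
        fun j _ => hC j _ (apply_mem_Icc_of_mem_scaledSimplex ht j)) (hD _ hsum) (abs_nonneg _)
        (Finset.prod_nonneg fun j _ => hC0 j)
    · rw [simplexIntegrand, indicator_of_notMem ht, abs_zero]
      exact mul_nonneg (Finset.prod_nonneg fun j _ => hC0 j) hD0

/-- The simplex integrand `1[t ∈ B·R_{n+1}] Π_j f_j(t_j) φ(Σ_j t_j)` is integrable on `ℝ^{n+1}`
(tame on a set of finite measure). -/
theorem integrable_simplexIntegrand (n : ℕ) (f : Fin (n + 1) → ES) (B : ℝ) {φ : ℝ → ℝ}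
    (hφ : TestFn B φ) : Integrable (simplexIntegrand n f B φ) :=
  (tame_simplexIntegrand n f B hφ).integrable (volume_scaledSimplex_lt_top _ _).ne

/-! ### Base case: one coordinate -/

/-- Base case `n = 0` of Lemma 6.1(a): in one coordinate the simplex integral is
`∫_0^B f_0(v) φ(v) dv`. -/
theorem integral_simplex_one (f : Fin 1 → ES) (B : ℝ) (hB : 0 ≤ B) (φ : ℝ → ℝ) :
    ∫ t, simplexIntegrand 0 f B φ t = ∫ v in (0 : ℝ)..B, ES.eval (f 0) v * φ v := by
  have h1 := ((volume_preserving_funUnique (Fin 1) ℝ).symm).integral_comp'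
    (g := simplexIntegrand 0 f B φ)
  refine Eq.trans h1.symm ?_
  have h2 : (fun x : ℝ => simplexIntegrand 0 f B φ ((MeasurableEquiv.funUnique (Fin 1) ℝ).symm x)) =
      (Icc 0 B).indicator fun v => ES.eval (f 0) v * φ v := by
    funext x
    have hmem : ((MeasurableEquiv.funUnique (Fin 1) ℝ).symm x) ∈ scaledSimplex 1 B ↔ x ∈ Icc 0 B := by
      simp [scaledSimplex, MeasurableEquiv.funUnique, Fin.forall_fin_one]
    by_cases hx : x ∈ Icc 0 B
    · rw [simplexIntegrand, indicator_of_mem (hmem.2 hx), indicator_of_mem hx]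
      simp [MeasurableEquiv.funUnique]
    · rw [simplexIntegrand, indicator_of_notMem (fun h => hx (hmem.1 h)), indicator_of_notMem hx]
  rw [h2, MeasureTheory.integral_indicator measurableSet_Icc, integral_of_le hB, integral_Icc_eq_integral_Ioc]

/-! ### Peeling the first coordinate -/

section Step

variable {n : ℕ}

/-- For `B < 0` the simplex `B·R_{n+1}` is empty and the simplex integrand vanishes identically. -/
theorem simplexIntegrand_eq_zero_of_neg (f : Fin (n + 1) → ES) {B : ℝ} (hB : B < 0) (φ : ℝ → ℝ)
    (t : Fin (n + 1) → ℝ) : simplexIntegrand n f B φ t = 0 := by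
  apply indicator_of_notMem
  intro ht
  have : 0 ≤ ∑ j, t j := Finset.sum_nonneg fun j _ => ht.1 j
  linarith [ht.2]

/-- `Φ(s, t') = 1[0 ≤ s] f₀(s) · Φ'(t')` with `Φ'` the simplex integrand of the tail on `(B − s)·R`. -/
theorem simplexIntegrand_cons (f : Fin (n + 2) → ES) (B : ℝ) (φ : ℝ → ℝ) (s : ℝ) (t' : Fin (n + 1) → ℝ) :
    simplexIntegrand (n + 1) f B φ (Fin.cons s t') =
      (Ici (0 : ℝ)).indicator (fun s => ES.eval (f 0) s) s *
        simplexIntegrand n (Fin.tail f) (B - s) (fun v => φ (s + v)) t' := by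
  have hprod : ∏ j : Fin (n + 2), ES.eval (f j) ((Fin.cons s t' : Fin (n + 2) → ℝ) j) =
      ES.eval (f 0) s * ∏ j : Fin (n + 1), ES.eval (Fin.tail f j) (t' j) := by
    rw [Fin.prod_univ_succ]; simp [Fin.tail]
  by_cases hs : 0 ≤ s
  · by_cases ht : t' ∈ scaledSimplex (n + 1) (B - s)
    · have hmem : (Fin.cons s t' : Fin (n + 2) → ℝ) ∈ scaledSimplex (n + 2) B := by
        rw [mem_scaledSimplex_cons_iff]; exact ⟨hs, ht.1, by linarith [ht.2]⟩
      rw [simplexIntegrand, indicator_of_mem hmem, simplexIntegrand, indicator_of_mem ht,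
        indicator_of_mem (mem_Ici.2 hs), hprod, sum_cons]
      ring
    · have hmem : (Fin.cons s t' : Fin (n + 2) → ℝ) ∉ scaledSimplex (n + 2) B := by
        rw [mem_scaledSimplex_cons_iff]
        rintro ⟨-, h1, h2⟩
        exact ht ⟨h1, by linarith⟩
      rw [simplexIntegrand, indicator_of_notMem hmem, simplexIntegrand, indicator_of_notMem ht, mul_zero]
  · have hmem : (Fin.cons s t' : Fin (n + 2) → ℝ) ∉ scaledSimplex (n + 2) B := by
      rw [mem_scaledSimplex_cons_iff]; exact fun h => hs h.1
    rw [simplexIntegrand, indicator_of_notMem hmem, indicator_of_notMem (by simpa using hs), zero_mul]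

/-- The inner integral over the tail, for every `s`. -/
theorem integral_simplexIntegrand_cons (f : Fin (n + 2) → ES) (B : ℝ) (φ : ℝ → ℝ)
    (IH : ∀ s ∈ Icc (0 : ℝ) B,
      ∫ t', simplexIntegrand n (Fin.tail f) (B - s) (fun v => φ (s + v)) t' =
        ∫ v in (0 : ℝ)..(B - s), EP.eval (dens n (Fin.tail f)) v * φ (s + v))
    (s : ℝ) :
    ∫ t', simplexIntegrand (n + 1) f B φ (Fin.cons s t') =
      (Icc (0 : ℝ) B).indicator (fun s => ES.eval (f 0) s *
        ∫ v in (0 : ℝ)..(B - s), EP.eval (dens n (Fin.tail f)) v * φ (s + v)) s := by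
  simp_rw [simplexIntegrand_cons]
  rw [MeasureTheory.integral_const_mul]
  by_cases hs : s ∈ Icc (0 : ℝ) B
  · rw [indicator_of_mem hs, indicator_of_mem (mem_Ici.2 hs.1), IH s hs]
  · rw [indicator_of_notMem hs]
    by_cases hs0 : 0 ≤ s
    · have hB : B - s < 0 := by
        simp only [mem_Icc, not_and, not_le] at hs
        linarith [hs hs0]
      simp [simplexIntegrand_eq_zero_of_neg _ hB]
    · rw [indicator_of_notMem (by simpa using hs0), zero_mul]

/-- Translation `v ↦ u = s + v` in the one-dimensional pairing. -/
theorem pairing_translate (H' : ℝ → ℝ) (φ : ℝ → ℝ) (s B : ℝ) :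
    ∫ v in (0 : ℝ)..(B - s), H' v * φ (s + v) = ∫ u in s..B, H' (u - s) * φ u := by
  have h := intervalIntegral.integral_comp_add_right (a := 0) (b := B - s)
    (fun u => H' (u - s) * φ u) s
  simp only [add_sub_cancel_right, zero_add, sub_add_cancel] at h
  rw [← h]
  congr 1; funext v; rw [add_comm]

/-- Reflection `s ↦ w = u − s` in the convolution integral. -/
theorem conv_reflect (f0 H' : ℝ → ℝ) (u : ℝ) :
    ∫ s in (0 : ℝ)..u, f0 s * H' (u - s) = ∫ w in (0 : ℝ)..u, f0 (u - w) * H' w := by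
  have h := intervalIntegral.integral_comp_sub_left (a := 0) (b := u) (fun w => f0 (u - w) * H' w) u
  simp only [sub_sub_cancel, sub_self, sub_zero] at h
  exact h

/-! #### The Fubini swap on the triangle `0 ≤ s ≤ u ≤ B` -/

/-- The triangle kernel. -/
def triK (f0 H' φ : ℝ → ℝ) (B : ℝ) (p : ℝ × ℝ) : ℝ :=
  {p : ℝ × ℝ | 0 < p.1 ∧ p.1 ≤ B ∧ p.1 < p.2 ∧ p.2 ≤ B}.indicator
    (fun p => f0 p.1 * (H' (p.2 - p.1) * φ p.2)) p

/-- The triangle `{(s, u) : 0 < s ≤ B, s < u ≤ B}` is a measurable subset of `ℝ × ℝ`. -/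
theorem measurableSet_tri (B : ℝ) :
    MeasurableSet {p : ℝ × ℝ | 0 < p.1 ∧ p.1 ≤ B ∧ p.1 < p.2 ∧ p.2 ≤ B} := by
  have h1 : MeasurableSet {p : ℝ × ℝ | 0 < p.1} := measurableSet_lt measurable_const measurable_fst
  have h2 : MeasurableSet {p : ℝ × ℝ | p.1 ≤ B} := measurableSet_le measurable_fst measurable_const
  have h3 : MeasurableSet {p : ℝ × ℝ | p.1 < p.2} := measurableSet_lt measurable_fst measurable_snd
  have h4 : MeasurableSet {p : ℝ × ℝ | p.2 ≤ B} := measurableSet_le measurable_snd measurable_const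
  have : {p : ℝ × ℝ | 0 < p.1 ∧ p.1 ≤ B ∧ p.1 < p.2 ∧ p.2 ≤ B} =
      {p : ℝ × ℝ | 0 < p.1} ∩ {p | p.1 ≤ B} ∩ {p | p.1 < p.2} ∩ {p | p.2 ≤ B} := by
    ext p; simp [and_assoc]
  rw [this]
  exact ((h1.inter h2).inter h3).inter h4

/-- The triangle integrand `triK f₀ H' φ B` is integrable on `ℝ × ℝ` for continuous `f₀`, `H'` and a
test function `φ` on `[0, B]` (bounded, supported in the bounded triangle). -/
theorem integrable_triK {f0 H' φ : ℝ → ℝ} (hf0 : Continuous f0) (hH' : Continuous H')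
    {B : ℝ} (hφ : TestFn B φ) : Integrable (triK f0 H' φ B) := by
  obtain ⟨C0, hC00, hC0⟩ := exists_bound_Icc_of_continuous hf0 0 B
  obtain ⟨C1, hC10, hC1⟩ := exists_bound_Icc_of_continuous hH' 0 B
  obtain ⟨D, hD0, hD⟩ := hφ.bdd
  have hT : Tame (Icc (0 : ℝ) B ×ˢ Icc (0 : ℝ) B) (triK f0 H' φ B) := by
    refine ⟨?_, ⟨C0 * (C1 * D), by positivity, fun p => ?_⟩, fun p hp => ?_⟩
    · refine Measurable.indicator ?_ (measurableSet_tri B)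
      exact (hf0.measurable.comp measurable_fst).mul
        ((hH'.measurable.comp (measurable_snd.sub measurable_fst)).mul (hφ.measurable.comp measurable_snd))
    · unfold triK
      by_cases hp : p ∈ {p : ℝ × ℝ | 0 < p.1 ∧ p.1 ≤ B ∧ p.1 < p.2 ∧ p.2 ≤ B}
      · rw [indicator_of_mem hp, abs_mul, abs_mul]
        obtain ⟨h1, h2, h3, h4⟩ := hp
        exact mul_le_mul (hC0 _ ⟨h1.le, h2⟩)
          (mul_le_mul (hC1 _ ⟨by linarith, by linarith⟩) (hD _ ⟨by linarith, h4⟩) (abs_nonneg _) hC10)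
          (by positivity) hC00
      · rw [indicator_of_notMem hp, abs_zero]; positivity
    · apply indicator_of_notMem
      intro h
      obtain ⟨h1, h2, h3, h4⟩ := h
      exact hp ⟨⟨h1.le, h2⟩, ⟨by linarith, h4⟩⟩
  apply hT.integrable
  rw [show (volume : Measure (ℝ × ℝ)) = (volume : Measure ℝ).prod volume from rfl, Measure.prod_prod]
  exact (ENNReal.mul_lt_top measure_Icc_lt_top measure_Icc_lt_top).ne

/-- Row sections of the triangle kernel: for fixed `s`. -/
theorem integral_triK_snd (f0 H' φ : ℝ → ℝ) {B : ℝ} (s : ℝ) :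
    ∫ u, triK f0 H' φ B (s, u) =
      (Ioc (0 : ℝ) B).indicator (fun s => f0 s * ∫ u in s..B, H' (u - s) * φ u) s := by
  by_cases hs : s ∈ Ioc (0 : ℝ) B
  · rw [indicator_of_mem hs]
    have hfun : (fun u => triK f0 H' φ B (s, u)) =
        fun u => f0 s * (Ioc s B).indicator (fun u => H' (u - s) * φ u) u := by
      funext u
      unfold triK
      by_cases hu : u ∈ Ioc s B
      · rw [indicator_of_mem hu, indicator_of_mem]; exact ⟨hs.1, hs.2, hu.1, hu.2⟩
      · rw [indicator_of_notMem hu, mul_zero, indicator_of_notMem]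
        rintro ⟨-, -, h3, h4⟩; exact hu ⟨h3, h4⟩
    rw [hfun, MeasureTheory.integral_const_mul, MeasureTheory.integral_indicator measurableSet_Ioc,
      integral_of_le hs.2]
  · rw [indicator_of_notMem hs]
    have hfun : (fun u => triK f0 H' φ B (s, u)) = fun _ => 0 := by
      funext u
      unfold triK
      rw [indicator_of_notMem]
      rintro ⟨h1, h2, -, -⟩; exact hs ⟨h1, h2⟩
    rw [hfun, integral_zero]

/-- Column sections of the triangle kernel: for fixed `u`. -/
theorem integral_triK_fst (f0 H' φ : ℝ → ℝ) {B : ℝ} (u : ℝ) :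
    ∫ s, triK f0 H' φ B (s, u) =
      (Ioc (0 : ℝ) B).indicator (fun u => φ u * ∫ s in (0 : ℝ)..u, f0 s * H' (u - s)) u := by
  by_cases hu : u ∈ Ioc (0 : ℝ) B
  · rw [indicator_of_mem hu]
    have hfun : (fun s => triK f0 H' φ B (s, u)) =
        fun s => φ u * (Ioo 0 u).indicator (fun s => f0 s * H' (u - s)) s := by
      funext s
      unfold triK
      by_cases hs : s ∈ Ioo 0 u
      · rw [indicator_of_mem hs, indicator_of_mem]
        · ring
        · exact ⟨hs.1, by linarith [hs.2, hu.2], hs.2, hu.2⟩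
      · rw [indicator_of_notMem hs, mul_zero, indicator_of_notMem]
        rintro ⟨h1, -, h3, -⟩; exact hs ⟨h1, h3⟩
    rw [hfun, MeasureTheory.integral_const_mul, MeasureTheory.integral_indicator measurableSet_Ioo,
      integral_of_le hu.1.le, integral_Ioc_eq_integral_Ioo]
  · rw [indicator_of_notMem hu]
    have hfun : (fun s => triK f0 H' φ B (s, u)) = fun _ => 0 := by
      funext s
      unfold triK
      rw [indicator_of_notMem]
      rintro ⟨h1, -, h3, h4⟩; exact hu ⟨by linarith, h4⟩
    rw [hfun, integral_zero]

/-- Fubini on the triangle. -/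
theorem triangle_swap {f0 H' φ : ℝ → ℝ} (hf0 : Continuous f0) (hH' : Continuous H') {B : ℝ}
    (hB : 0 ≤ B) (hφ : TestFn B φ) :
    ∫ s in (0 : ℝ)..B, f0 s * ∫ u in s..B, H' (u - s) * φ u =
      ∫ u in (0 : ℝ)..B, φ u * ∫ s in (0 : ℝ)..u, f0 s * H' (u - s) := by
  have hswap := MeasureTheory.integral_integral_swap
    (f := fun s u => triK f0 H' φ B (s, u)) (integrable_triK hf0 hH' hφ)
  have hL : ∫ s, ∫ u, triK f0 H' φ B (s, u) = ∫ s in (0 : ℝ)..B, f0 s * ∫ u in s..B, H' (u - s) * φ u := by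
    simp_rw [integral_triK_snd]
    rw [MeasureTheory.integral_indicator measurableSet_Ioc, integral_of_le hB]
  have hR : ∫ u, ∫ s, triK f0 H' φ B (s, u) =
      ∫ u in (0 : ℝ)..B, φ u * ∫ s in (0 : ℝ)..u, f0 s * H' (u - s) := by
    simp_rw [integral_triK_fst]
    rw [MeasureTheory.integral_indicator measurableSet_Ioc, integral_of_le hB]
  rw [← hL, ← hR]
  exact hswap

end Step

end

end Summit.Parity.GeneralizedHardyLittlewood.Theorems.Dhl42.ClosedForm
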